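import Mathlib
import Summits.MatrixMultiplication.MatrixMultiplication.Theorems.SubgroupIdentityDesigns.Negative.LeviCollisionRigidPair

/-!
# Level `k = 1` sandwich triples: the corner-`1` slice of `H₁H₂H₃` is `U⁻U⁺`
(negative-lemma support for the crux `SubgroupIdentityDesigns`, stmt-MatrixMultiplication-14079; line
`ghost-calculus-chebotarev`, stub `stub_levelOneCornerSlice`)

In `G = GL_{n+1}(𝔽_p)`, `n ≥ 2`, let `U⁻ = {[[1,0],[X,1]]}` (blocks along `Fin 1 ⊕ Fin n`; `u - 1`
supported in rows `≥ 1`, column `0`) and `U⁺ = {[[1,Z],[0,1]]}`.  Suppose `U⁻ ≤ H₁`, `U⁺ ≤ H₃` and the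
triple `(H₁, H₂, H₃)` passes the level-`1` identity test of the crux (a Fourier table `c` supported in rank
`≤ 1` with `f_c(1) = 1` and `f_c(abg) = 0` for `abg ≠ 1`).  Then every product `x = abg` with corner entry
`x₀₀ = 1` factors as `u v`, `u ∈ U⁻`, `v ∈ U⁺` (`stub_levelOneCornerSlice`).

Proof: write `x = [[1, r],[c, B]] = g(c, D, r)` with the Schur complement `D = B - c r`
(`g(X,s,Z) = [[1,Z],[X,XZ+s]] = blockPt X s Z` of `Negative.LeviCollision`).  If `D = 1` then
`x = g(c,1,0) · g(0,1,r) ∈ U⁻U⁺`.  If `D ≠ 1`: `g(X - c, 1, 0) · x · g(0, 1, Z - r) = g(X, D, Z)` and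
`g(X,1,0) · 1 · g(0,1,Z) = g(X,1,Z)` lie in `H₁H₂H₃`, a collision pair `γ (D - 1) β = 0` exists since
`2 · 1 ≤ n` (`exists_leviCollision_pair`), and `no_idTest_of_leviCollision` (transported along
`Fin 1 ⊕ Fin n ≃ Fin (n + 1)`) refutes the identity test.
-/

set_option linter.dupNamespace false

noncomputable section

open scoped BigOperators
open Matrix

namespace Summit.MatrixMultiplication.MatrixMultiplication.Theorems.SubgroupIdentityDesigns.Negative

namespace LevelOneCornerSlice

open Summit.MatrixMultiplication.MatrixMultiplication.Theorems.LieRankDesigns.Negative (GLm Mat)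

section Blocks

variable {F : Type*} [CommRing F] {κ ρ : Type*} [Fintype κ] [Fintype ρ] [DecidableEq κ] [DecidableEq ρ]

/-- `g(X₁, 1, 0) · g(X₂, s, Z) = g(X₁ + X₂, s, Z)` (left translation by `U⁻`). -/
theorem blockPt_one_zero_mul (X₁ X₂ : Matrix ρ κ F) (s : Matrix ρ ρ F) (Z : Matrix κ ρ F) :
    blockPt X₁ 1 0 * blockPt X₂ s Z = blockPt (X₁ + X₂) s Z := by
  simp [blockPt, Matrix.fromBlocks_multiply, Matrix.add_mul, add_assoc]

/-- `g(X, s, Z) · g(0, 1, Z₁) = g(X, s, Z + Z₁)` (right translation by `U⁺`). -/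
theorem blockPt_mul_zero_one (X : Matrix ρ κ F) (s : Matrix ρ ρ F) (Z Z₁ : Matrix κ ρ F) :
    blockPt X s Z * blockPt 0 1 Z₁ = blockPt X s (Z + Z₁) := by
  rw [blockPt, blockPt, blockPt, Matrix.fromBlocks_multiply]
  congr 1 <;> simp [Matrix.mul_add] <;> abel

/-- `det g(X, s, Z) = det s` (Schur complement). -/
theorem det_blockPt (X : Matrix ρ κ F) (s : Matrix ρ ρ F) (Z : Matrix κ ρ F) : (blockPt X s Z).det = s.det := by
  rw [blockPt, Matrix.det_fromBlocks_one₁₁, add_sub_cancel_left]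

omit [Fintype ρ] [DecidableEq ρ] in
/-- A block matrix with corner block `1` is the block point of its Schur complement:
`[[1, r],[c, B]] = g(c, B - c r, r)`. -/
theorem eq_blockPt_of_toBlocks₁₁ (M : Matrix (κ ⊕ ρ) (κ ⊕ ρ) F) (h : M.toBlocks₁₁ = 1) :
    M = blockPt M.toBlocks₂₁ (M.toBlocks₂₂ - M.toBlocks₂₁ * M.toBlocks₁₂) M.toBlocks₁₂ := by
  conv_lhs => rw [← Matrix.fromBlocks_toBlocks M]
  rw [blockPt, h, add_sub_cancel]

end Blocks

section Transport

variable {R : Type*} [CommRing R] {ι : Type*} {m : ℕ}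

/-- Trace is invariant under reindexing. -/
theorem trace_reindex [Fintype ι] (e : ι ≃ Fin m) (N : Matrix ι ι R) :
    Matrix.trace (Matrix.reindex e e N) = Matrix.trace N := by
  rw [Matrix.reindex_apply, Matrix.trace, Matrix.trace]
  exact Fintype.sum_equiv e.symm _ _ fun i => rfl

/-- Reindexing is multiplicative. -/
theorem reindex_mul_reindex [Fintype ι] (e : ι ≃ Fin m) (M N : Matrix ι ι R) :
    Matrix.reindex e e M * Matrix.reindex e e N = Matrix.reindex e e (M * N) := by
  rw [Matrix.reindex_apply, Matrix.reindex_apply, Matrix.submatrix_mul_equiv, Matrix.reindex_apply]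

/-- Entries of `e(M) - 1` at transported positions. -/
theorem reindex_sub_one_apply [DecidableEq ι] (e : ι ≃ Fin m) (M : Matrix ι ι R) (i j : ι) :
    (Matrix.reindex e e M - 1) (e i) (e j) = (M - 1) i j := by
  simp [Matrix.one_apply]

variable [Fintype ι] [DecidableEq ι] {p : ℕ} [Fact p.Prime]

/-- Transport of the Fourier function along `e : ι ≃ Fin m`: `f_c(e B) = Σ_{M'} c(e M') ψ(tr(M' B))`. -/
theorem fourier_reindex (e : ι ≃ Fin m) (c : Mat p m → ℂ) (B : Matrix ι ι (ZMod p)) :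
    (∑ M : Mat p m, c M * ZMod.stdAddChar (Matrix.trace (M * Matrix.reindex e e B))) =
      ∑ M' : Matrix ι ι (ZMod p), c (Matrix.reindex e e M') * ZMod.stdAddChar (Matrix.trace (M' * B)) := by
  refine Fintype.sum_equiv (Matrix.reindex e e).symm _ _ fun M => ?_
  have hM : M = Matrix.reindex e e ((Matrix.reindex e e).symm M) := ((Matrix.reindex e e).apply_symm_apply M).symm
  conv_lhs => rw [hM]
  rw [reindex_mul_reindex, trace_reindex]

/-- A matrix of determinant `≠ 0`, transported to `Fin m`, is (the value of) an element of `GL_m(𝔽_p)`. -/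
theorem exists_gl_val_eq (e : ι ≃ Fin m) (M : Matrix ι ι (ZMod p)) (hM : M.det ≠ 0) :
    ∃ u : GLm p m, (u : Mat p m) = Matrix.reindex e e M :=
  ⟨Matrix.GeneralLinearGroup.mkOfDetNeZero _ (by rwa [Matrix.det_reindex_self]), rfl⟩

end Transport

section Unipotents

variable {p : ℕ} {n : ℕ}

/-- `e(g(X, 1, 0)) = e([[1,0],[X,1]])` satisfies the LOWER support predicate (`u - 1` lives in rows `≥ 1`,
column `0`) whenever `e` sends `inl` to `{0}` and `inr` to `{1, …, n}`. -/
theorem lower_of_val_eq (e : Fin 1 ⊕ Fin n ≃ Fin (n + 1)) (he₀ : ∀ j : Fin 1, (e (Sum.inl j)).val < 1)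
    (he₁ : ∀ i : Fin n, 1 ≤ (e (Sum.inr i)).val) (X : Matrix (Fin n) (Fin 1) (ZMod p)) {u : GLm p (n + 1)}
    (hu : (u : Mat p (n + 1)) = Matrix.reindex e e (blockPt X 1 0)) :
    ∀ i j : Fin (n + 1), ((u : Mat p (n + 1)) - 1) i j ≠ 0 → 1 ≤ i.val ∧ j.val < 1 := by
  intro i j hij
  obtain ⟨i', rfl⟩ := e.surjective i
  obtain ⟨j', rfl⟩ := e.surjective j
  rw [hu, reindex_sub_one_apply] at hij
  rcases i' with i' | i' <;> rcases j' with j' | j'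
  · simp [blockPt, Matrix.one_apply] at hij
  · simp [blockPt] at hij
  · exact ⟨he₁ i', he₀ j'⟩
  · simp [blockPt, Matrix.one_apply] at hij

/-- `e(g(0, 1, Z)) = e([[1,Z],[0,1]])` satisfies the UPPER support predicate (`v - 1` lives in row `0`,
columns `≥ 1`). -/
theorem upper_of_val_eq (e : Fin 1 ⊕ Fin n ≃ Fin (n + 1)) (he₀ : ∀ j : Fin 1, (e (Sum.inl j)).val < 1)
    (he₁ : ∀ i : Fin n, 1 ≤ (e (Sum.inr i)).val) (Z : Matrix (Fin 1) (Fin n) (ZMod p)) {v : GLm p (n + 1)}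
    (hv : (v : Mat p (n + 1)) = Matrix.reindex e e (blockPt 0 1 Z)) :
    ∀ i j : Fin (n + 1), ((v : Mat p (n + 1)) - 1) i j ≠ 0 → i.val < 1 ∧ 1 ≤ j.val := by
  intro i j hij
  obtain ⟨i', rfl⟩ := e.surjective i
  obtain ⟨j', rfl⟩ := e.surjective j
  rw [hv, reindex_sub_one_apply] at hij
  rcases i' with i' | i' <;> rcases j' with j' | j'
  · simp [blockPt, Matrix.one_apply] at hij
  · exact ⟨he₀ i', he₁ j'⟩
  · simp [blockPt] at hij
  · simp [blockPt, Matrix.one_apply] at hij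

variable [Fact p.Prime]

/-- If a product `x ∈ GL_{n+1}(𝔽_p)` has transported block form `g(X, 1, Z)` (Schur complement `1`) then
`x = e(g(X,1,0)) · e(g(0,1,Z)) ∈ U⁻U⁺`. -/
theorem exists_lower_mul_upper (e : Fin 1 ⊕ Fin n ≃ Fin (n + 1)) (he₀ : ∀ j : Fin 1, (e (Sum.inl j)).val < 1)
    (he₁ : ∀ i : Fin n, 1 ≤ (e (Sum.inr i)).val) (X : Matrix (Fin n) (Fin 1) (ZMod p))
    (Z : Matrix (Fin 1) (Fin n) (ZMod p)) {x : GLm p (n + 1)}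
    (hx : (x : Mat p (n + 1)) = Matrix.reindex e e (blockPt X 1 Z)) :
    ∃ u v : GLm p (n + 1),
      (∀ i j : Fin (n + 1), ((u : Mat p (n + 1)) - 1) i j ≠ 0 → 1 ≤ i.val ∧ j.val < 1) ∧
      (∀ i j : Fin (n + 1), ((v : Mat p (n + 1)) - 1) i j ≠ 0 → i.val < 1 ∧ 1 ≤ j.val) ∧ x = u * v := by
  obtain ⟨u, hu⟩ := exists_gl_val_eq e (blockPt X 1 (0 : Matrix (Fin 1) (Fin n) (ZMod p)))
    (by rw [det_blockPt, Matrix.det_one]; exact one_ne_zero)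
  obtain ⟨v, hv⟩ := exists_gl_val_eq e (blockPt (0 : Matrix (Fin n) (Fin 1) (ZMod p)) 1 Z)
    (by rw [det_blockPt, Matrix.det_one]; exact one_ne_zero)
  refine ⟨u, v, lower_of_val_eq e he₀ he₁ X hu, upper_of_val_eq e he₀ he₁ Z hv, Units.ext ?_⟩
  rw [Units.val_mul, hu, hv, hx, reindex_mul_reindex, blockPt_one_zero_mul, add_zero]

/-- **Levi collision at level `1`.**  If `U⁻ ≤ H₁`, `U⁺ ≤ H₃`, the triple passes the level-`1` identity
test, and some product `abg` has transported block form `g(X₀, D, Z₀)` with `D ≠ 1`, contradiction: all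
`g(X, D, Z)` and `g(X, 1, Z)` lie in `H₁H₂H₃`, and a collision pair for `D - 1` exists as `2 ≤ n`. -/
theorem false_of_idTest_of_schur_ne_one (hn : 2 ≤ n) (e : Fin 1 ⊕ Fin n ≃ Fin (n + 1))
    (he₀ : ∀ j : Fin 1, (e (Sum.inl j)).val < 1) (he₁ : ∀ i : Fin n, 1 ≤ (e (Sum.inr i)).val)
    {H₁ H₂ H₃ : Subgroup (GLm p (n + 1))}
    (hU : ∀ u : GLm p (n + 1),
      (∀ i j : Fin (n + 1), ((u : Mat p (n + 1)) - 1) i j ≠ 0 → 1 ≤ i.val ∧ j.val < 1) → u ∈ H₁)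
    (hV : ∀ v : GLm p (n + 1),
      (∀ i j : Fin (n + 1), ((v : Mat p (n + 1)) - 1) i j ≠ 0 → i.val < 1 ∧ 1 ≤ j.val) → v ∈ H₃)
    (c : Mat p (n + 1) → ℂ) (hc : ∀ M, 1 < M.rank → c M = 0)
    (h1 : (∑ M : Mat p (n + 1),
      c M * ZMod.stdAddChar (Matrix.trace (M * ((1 : GLm p (n + 1)) : Mat p (n + 1))))) = 1)
    (h0 : ∀ a ∈ H₁, ∀ b ∈ H₂, ∀ g ∈ H₃, a * b * g ≠ 1 → (∑ M : Mat p (n + 1),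
      c M * ZMod.stdAddChar (Matrix.trace (M * ((a * b * g : GLm p (n + 1)) : Mat p (n + 1))))) = 0)
    {a b g : GLm p (n + 1)} (ha : a ∈ H₁) (hb : b ∈ H₂) (hg : g ∈ H₃)
    (X₀ : Matrix (Fin n) (Fin 1) (ZMod p)) (D : Matrix (Fin n) (Fin n) (ZMod p))
    (Z₀ : Matrix (Fin 1) (Fin n) (ZMod p))
    (hx : ((a * b * g : GLm p (n + 1)) : Mat p (n + 1)) = Matrix.reindex e e (blockPt X₀ D Z₀)) (hD : D ≠ 1) :
    False := by
  obtain ⟨γ, β, γ', β', hγ, hβ, hcol⟩ :=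
    exists_leviCollision_pair (F := ZMod p) (k := 1) (r := n) (by omega) (D - 1)
  have hdet : ∀ (X : Matrix (Fin n) (Fin 1) (ZMod p)) (Z : Matrix (Fin 1) (Fin n) (ZMod p)),
      (blockPt X (1 : Matrix (Fin n) (Fin n) (ZMod p)) Z).det ≠ 0 := fun X Z => by
    rw [det_blockPt, Matrix.det_one]; exact one_ne_zero
  -- the transported product set `H₁H₂H₃`
  let S : Set (Matrix (Fin 1 ⊕ Fin n) (Fin 1 ⊕ Fin n) (ZMod p)) :=
    {s | ∃ a ∈ H₁, ∃ b ∈ H₂, ∃ g ∈ H₃,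
      Matrix.reindex e e s = ((a * b * g : GLm p (n + 1)) : Mat p (n + 1))}
  have hSt : ∀ (X : Matrix (Fin n) (Fin 1) (ZMod p)) (Z : Matrix (Fin 1) (Fin n) (ZMod p)),
      blockPt X D Z ∈ S := by
    intro X Z
    obtain ⟨u, hu⟩ := exists_gl_val_eq e _ (hdet (X - X₀) 0)
    obtain ⟨v, hv⟩ := exists_gl_val_eq e _ (hdet 0 (Z - Z₀))
    refine ⟨u * a, H₁.mul_mem (hU u (lower_of_val_eq e he₀ he₁ _ hu)) ha, b, hb, g * v,
      H₃.mul_mem hg (hV v (upper_of_val_eq e he₀ he₁ _ hv)), ?_⟩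
    have hassoc : u * a * b * (g * v) = u * (a * b * g) * v := by simp only [mul_assoc]
    rw [hassoc, Units.val_mul, Units.val_mul, hu, hx, hv, reindex_mul_reindex, reindex_mul_reindex,
      blockPt_one_zero_mul, sub_add_cancel, blockPt_mul_zero_one, add_sub_cancel]
  have hS1 : ∀ (X : Matrix (Fin n) (Fin 1) (ZMod p)) (Z : Matrix (Fin 1) (Fin n) (ZMod p)),
      blockPt X 1 Z ∈ S := by
    intro X Z
    obtain ⟨u, hu⟩ := exists_gl_val_eq e _ (hdet X 0)
    obtain ⟨v, hv⟩ := exists_gl_val_eq e _ (hdet 0 Z)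
    refine ⟨u, hU u (lower_of_val_eq e he₀ he₁ _ hu), 1, H₂.one_mem, v,
      hV v (upper_of_val_eq e he₀ he₁ _ hv), ?_⟩
    rw [mul_one, Units.val_mul, hu, hv, reindex_mul_reindex, blockPt_one_zero_mul, add_zero]
  -- the transported coefficient table
  let c' : Matrix (Fin 1 ⊕ Fin n) (Fin 1 ⊕ Fin n) (ZMod p) → ℂ := fun M' => c (Matrix.reindex e e M')
  have hc' : ∀ M', Fintype.card (Fin 1) < M'.rank → c' M' = 0 := by
    intro M' hM'
    apply hc
    rw [Matrix.rank_reindex]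
    simpa using hM'
  have h1' : (∑ M' : Matrix (Fin 1 ⊕ Fin n) (Fin 1 ⊕ Fin n) (ZMod p),
      c' M' * ZMod.stdAddChar (Matrix.trace (M' * 1))) = 1 := by
    have := fourier_reindex e c 1
    rw [Matrix.reindex_apply, Matrix.submatrix_one_equiv] at this
    rw [← this]
    rwa [Units.val_one] at h1
  have h0' : ∀ s ∈ S, s ≠ 1 → (∑ M' : Matrix (Fin 1 ⊕ Fin n) (Fin 1 ⊕ Fin n) (ZMod p),
      c' M' * ZMod.stdAddChar (Matrix.trace (M' * s))) = 0 := by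
    rintro s ⟨a', ha', b', hb', g', hg', hs⟩ hs1
    have hne : a' * b' * g' ≠ 1 := by
      intro h
      apply hs1
      rw [h, Units.val_one] at hs
      have : s = (Matrix.reindex e e).symm 1 := by rw [← hs]; simp
      rw [this, Matrix.reindex_symm, Matrix.reindex_apply, Matrix.submatrix_one_equiv]
    have h := h0 a' ha' b' hb' g' hg' hne
    rw [← hs, fourier_reindex] at h
    exact h
  exact no_idTest_of_leviCollision γ β γ' β' hγ hβ D hD hcol S hSt hS1 c' hc' h1' h0'

/-- **The corner-`1` slice of a level-`1` sandwich is `U⁻U⁺`** (named-hypothesis form of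
`stub_levelOneCornerSlice`). -/
theorem cornerSlice (hn : 2 ≤ n) {H₁ H₂ H₃ : Subgroup (GLm p (n + 1))}
    (hU : ∀ u : GLm p (n + 1),
      (∀ i j : Fin (n + 1), ((u : Mat p (n + 1)) - 1) i j ≠ 0 → 1 ≤ i.val ∧ j.val < 1) → u ∈ H₁)
    (hV : ∀ v : GLm p (n + 1),
      (∀ i j : Fin (n + 1), ((v : Mat p (n + 1)) - 1) i j ≠ 0 → i.val < 1 ∧ 1 ≤ j.val) → v ∈ H₃)
    (hid : ∃ c : Mat p (n + 1) → ℂ, (∀ M, 1 < M.rank → c M = 0) ∧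
      (∑ M : Mat p (n + 1),
        c M * ZMod.stdAddChar (Matrix.trace (M * ((1 : GLm p (n + 1)) : Mat p (n + 1))))) = 1 ∧
      ∀ a ∈ H₁, ∀ b ∈ H₂, ∀ g ∈ H₃, a * b * g ≠ 1 → (∑ M : Mat p (n + 1),
        c M * ZMod.stdAddChar (Matrix.trace (M * ((a * b * g : GLm p (n + 1)) : Mat p (n + 1))))) = 0)
    {a b g : GLm p (n + 1)} (ha : a ∈ H₁) (hb : b ∈ H₂) (hg : g ∈ H₃)
    (h00 : ((a * b * g : GLm p (n + 1)) : Mat p (n + 1)) 0 0 = 1) :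
    ∃ u v : GLm p (n + 1),
      (∀ i j : Fin (n + 1), ((u : Mat p (n + 1)) - 1) i j ≠ 0 → 1 ≤ i.val ∧ j.val < 1) ∧
      (∀ i j : Fin (n + 1), ((v : Mat p (n + 1)) - 1) i j ≠ 0 → i.val < 1 ∧ 1 ≤ j.val) ∧
      a * b * g = u * v := by
  obtain ⟨c, hc, h1, h0⟩ := hid
  -- coordinates `Fin 1 ⊕ Fin n ≃ Fin (n + 1)`, `inl 0 ↦ 0`, `inr i ↦ i + 1`
  set e : Fin 1 ⊕ Fin n ≃ Fin (n + 1) := finSumFinEquiv.trans (finCongr (Nat.add_comm 1 n)) with he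
  have he₀ : ∀ j : Fin 1, (e (Sum.inl j)).val < 1 := fun j => by simp [he]
  have he₁ : ∀ i : Fin n, 1 ≤ (e (Sum.inr i)).val := fun i => by simp [he]
  have he00 : e (Sum.inl 0) = 0 := Fin.ext (by simpa using he₀ 0)
  -- block form of `x = abg`: corner block `1`, hence `x = e(g(c, D, r))` with the Schur complement `D`
  set x' : Matrix (Fin 1 ⊕ Fin n) (Fin 1 ⊕ Fin n) (ZMod p) :=
    (Matrix.reindex e e).symm ((a * b * g : GLm p (n + 1)) : Mat p (n + 1)) with hx'
  have hx : ((a * b * g : GLm p (n + 1)) : Mat p (n + 1)) = Matrix.reindex e e x' :=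
    ((Matrix.reindex e e).apply_symm_apply _).symm
  have h11 : x'.toBlocks₁₁ = 1 := by
    ext i j
    rw [Fin.fin_one_eq_zero i, Fin.fin_one_eq_zero j, Matrix.one_apply_eq]
    simp only [hx', Matrix.toBlocks₁₁, Matrix.of_apply, Matrix.reindex_symm, Matrix.reindex_apply,
      Equiv.symm_symm, Matrix.submatrix_apply, he00, h00]
  have hxb := eq_blockPt_of_toBlocks₁₁ x' h11
  by_cases hD : x'.toBlocks₂₂ - x'.toBlocks₂₁ * x'.toBlocks₁₂ = 1
  · rw [hD] at hxb
    rw [hxb] at hx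
    exact exists_lower_mul_upper e he₀ he₁ _ _ hx
  · rw [hxb] at hx
    exact (false_of_idTest_of_schur_ne_one hn e he₀ he₁ hU hV c hc h1 h0 ha hb hg _ _ _ hx hD).elim

end Unipotents

end LevelOneCornerSlice

/-- **Stub `stub_levelOneCornerSlice` (line `ghost-calculus-chebotarev`).**  For a level-`1` sandwich
`U⁻ ≤ H₁`, `U⁺ ≤ H₃` in `GL_{n+1}(𝔽_p)` (`n ≥ 2`) passing the level-`1` identity test, every product
`abg` (`a ∈ H₁`, `b ∈ H₂`, `g ∈ H₃`) with corner entry `(abg)₀₀ = 1` factors as `u v` with `u ∈ U⁻`,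
`v ∈ U⁺`. -/
theorem stub_levelOneCornerSlice :
    ∀ (p : ℕ) [Fact p.Prime] (n : ℕ), 2 ≤ n →
      ∀ (H₁ H₂ H₃ : Subgroup (Matrix.GeneralLinearGroup (Fin (n + 1)) (ZMod p))),
      (∀ u : Matrix.GeneralLinearGroup (Fin (n + 1)) (ZMod p),
        (∀ i j : Fin (n + 1), ((u : Matrix (Fin (n + 1)) (Fin (n + 1)) (ZMod p)) - 1) i j ≠ 0 →
          1 ≤ i.val ∧ j.val < 1) → u ∈ H₁) →
      (∀ v : Matrix.GeneralLinearGroup (Fin (n + 1)) (ZMod p),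
        (∀ i j : Fin (n + 1), ((v : Matrix (Fin (n + 1)) (Fin (n + 1)) (ZMod p)) - 1) i j ≠ 0 →
          i.val < 1 ∧ 1 ≤ j.val) → v ∈ H₃) →
      (∃ c : Matrix (Fin (n + 1)) (Fin (n + 1)) (ZMod p) → ℂ, (∀ M, 1 < M.rank → c M = 0) ∧
        (∑ M : Matrix (Fin (n + 1)) (Fin (n + 1)) (ZMod p), c M * ZMod.stdAddChar (Matrix.trace
          (M * ((1 : Matrix.GeneralLinearGroup (Fin (n + 1)) (ZMod p)) :
            Matrix (Fin (n + 1)) (Fin (n + 1)) (ZMod p))))) = 1 ∧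
        ∀ a ∈ H₁, ∀ b ∈ H₂, ∀ g ∈ H₃, a * b * g ≠ 1 →
          (∑ M : Matrix (Fin (n + 1)) (Fin (n + 1)) (ZMod p), c M * ZMod.stdAddChar (Matrix.trace
            (M * ((a * b * g : Matrix.GeneralLinearGroup (Fin (n + 1)) (ZMod p)) :
              Matrix (Fin (n + 1)) (Fin (n + 1)) (ZMod p))))) = 0) →
      ∀ a ∈ H₁, ∀ b ∈ H₂, ∀ g ∈ H₃,
        ((a * b * g : Matrix.GeneralLinearGroup (Fin (n + 1)) (ZMod p)) :
          Matrix (Fin (n + 1)) (Fin (n + 1)) (ZMod p)) 0 0 = 1 →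
        ∃ u v : Matrix.GeneralLinearGroup (Fin (n + 1)) (ZMod p),
          (∀ i j : Fin (n + 1), ((u : Matrix (Fin (n + 1)) (Fin (n + 1)) (ZMod p)) - 1) i j ≠ 0 →
            1 ≤ i.val ∧ j.val < 1) ∧
          (∀ i j : Fin (n + 1), ((v : Matrix (Fin (n + 1)) (Fin (n + 1)) (ZMod p)) - 1) i j ≠ 0 →
            i.val < 1 ∧ 1 ≤ j.val) ∧ a * b * g = u * v :=
  fun _ _ _ hn _ _ _ hU hV hid _ ha _ hb _ hg h00 => LevelOneCornerSlice.cornerSlice hn hU hV hid ha hb hg h00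

end Summit.MatrixMultiplication.MatrixMultiplication.Theorems.SubgroupIdentityDesigns.Negative

end
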